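import Literature.MathematicalPhysics.QuantumLattice.HubbardTTPrimeThermalWindowCertificate
import Literature.MathematicalPhysics.QuantumLattice.InfVolFermionStateTorusLimitSpinSectorGibbsD4
import Literature.MathematicalPhysics.QuantumLattice.InfVolFermionStateTorusLimitTwoSectorCompanionChain
import HarnessLib

/-!
# `t–t'` Hubbard model at `T > 0`: the thermal window certificate read in the COMPANION states of the
# two-sector energy–entropy balance (torus limits of the canonical states of ANY spin sector `(a_L, b_L)`)

Topic `Literature/MathematicalPhysics/QuantumLattice`; complement of `HubbardTTPrimeThermalWindowCertificate.lean`
/ `…D4.lean` (the `D₄`-reduced thermal window certificate bounds every torus limit of the canonical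
`(rectN n L, S^z = 0)` Gibbs states — the thermal object of record `ω`). The two-sector (charged)
energy–entropy balance rows pair `ω` with COMPANION torus limits `ω'` of the canonical eigen-mixtures of other
spin sectors (`(k_L ∓ 1, k_L)`, `(k_L − 1, k_L − 1)`, …; hypothesis-free existence:
`…TwoSectorCompanionExistence / …CompanionChain`). A sequential certificate (hubbard-thermal READER-LAW §3b:
first bound a moment of `ω'`, then use it as a constant in `ω`'s relaxation) needs the SAME reader for `ω'`.
All its rows are in the tree: eom rows and gauge-invariant EEB rows
(`InfVolFermionStateTorusLimitSpinSectorGibbsRows`), translation + point-group defects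
(`…SpinSectorGibbsD4`), charged words (`TorusSectorGibbsMixtureChargeRows`, any joint-sector mixture),
densities (`…SpinSectorDensity`, `…ReverseRow`, `…CompanionChain`). Hence:

* `IsTorusLimitOfMixture.re_expect_ge_of_thermal_certificate_d4_TT'_of_spinSectorGibbs` — for `ω'` a torus
  limit along `Ls → ∞` of the canonical eigen-mixtures (any presentation `(m, p, ψ, e)`) of
  `hubbardTorusTT' L t t' U` on the spin sectors `(a_L, b_L)`, every thermal window certificate (the operator
  identity of `re_expect_ge_of_thermal_certificate_TT'_of_rows`, `thicken Λ 1 ⊆ Λ'`, arbitrary `D₄` labels,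
  charged words of nonzero particle or spin charge, EEB generators conserving the local `N`, `S^z`,
  `e^{sᵣ−1} ≤ qᵣ`, `λᵣ, κₑ ≥ 0`, extra rows `Gₑ` with `0 ≤ Re ω'(Gₑ)`) proves
  `c − Σₖ‖aₖ‖ + Σ_σ μ_σ (Re ω'_{Λ'}(n_{0σ}) − ν) + κ (u − e^{tt'}(ω')) ≤ Re ω'_{Λ'}(Xw)` (densities left
  symbolic: they are `lim a_L/L²`, `lim b_L/L²` by `…re_expect_nAt_eq_of_spinSectorGibbs`);
* `…_of_predCompanion` — the «rm↑» companion `(k_L − 1, k_L)` of the object of record at filling `n`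
  (`0 ≤ n ≤ 2`): densities EVALUATED, `Re ω'(n_{0σ}) = n/2` for both spins, so the conclusion has the record
  shape `c − Σₖ‖aₖ‖ + (Σ_σ μ_σ)(n/2 − ν) + κ (u − e^{tt'}(ω')) ≤ Re ω'_{Λ'}(Xw)`; the extra rows `Gₑ` may be
  the companion's ENERGY-WINDOW rows (`…TwoSectorCompanionEnergyWindow`: `e(n) ≤ e^{tt'}(ω') ≤ e(n) + 2H_b(n/2)/β`)
  or the two-sector rows themselves;
* `…_of_pairCompanion` — the same for the pair companion `(k_L − 1, k_L − 1)`.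

WHAT THIS IS NOT: no spin-flip reduction for `a ≠ b` (the `Symm` reader of the record does not transfer);
no number; no claim `ω' = ω`. Everything is PROVED; no definition, no named fact.

## Mathlib / tree search

REUSED: `InfVolFermionState.re_expect_ge_of_thermal_certificate_TT'_of_rows` (`HubbardTTPrimeThermalWindowCertificate`),
`IsTorusLimitOfMixture.expect_commutator_localHamiltonian_eq_zero_of_spinSectorGibbs`,
`…re_expect_eeb_nonneg_of_spinSectorGibbs_of_thicken_subset` (`…SpinSectorGibbsRows`),
`…expect_d4Defect_eq_zero_of_spinSectorGibbs` (`…SpinSectorGibbsD4`), `…expect_ladderWord_eq_zero_of_szSector`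
(`TorusSectorGibbsMixtureChargeRows`), `expect_nAt_eq_expect_nAt_singleton`,
`…re_expect_nAt_up_eq_half_of_predCompanion` (`…ReverseRow`), `…re_expect_nAt_down_eq_half_of_predCompanion`,
`…down_eq_half_of_pairCompanion` (`…CompanionChain`), `mem_szSector_iff_spinConfig`. Pattern:
`…re_expect_ge_of_thermal_certificate_d4_TT'_of_sectorGibbs`. `lean search 'certificate.*spinSector'`: nothing
(2026-08-27).

## References

* H. Fawzi, O. Fawzi, S. O. Scalet (2024), §3.2–3.3, Thm. 3.6 (EEB-constrained relaxations bracket the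
  expectations of every KMS state; symmetry reduction). [cite: FawziFawziScalet2024, Thm. 3.6]
* X. Han, arXiv:2006.06002 (2020), §3 (square-lattice constraint set). [cite: Han2020Bootstrap, §3]
* I. Kull et al., PRX 14 (2024) 021008, §5.3 (rounded dual certificates). [cite: KullEtAl2024, §5.3]
-/

noncomputable section

namespace Literature.MathematicalPhysics.QuantumLattice

open Matrix Finset HubbardWave0 Literature.Probability.LatticeModels ThermodynamicLimit
open Literature.MathematicalPhysics.QuantumManyBody.StateRelaxation
open _root_.Filter
open scoped _root_.Topology ComplexOrder BigOperators

namespace InfVolFermionState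

/-- The components of a spin-sector canonical presentation lie in the joint sector `(a + b, (a − b)/2)`.
[cite: LiebPRL1989, Remark (2)] -/
theorem sectorEigenvector_presentation_mem_szSector (t t' U : ℝ) (a b : ℕ → ℕ) {m : ℕ → ℕ}
    {ψ : ∀ L, Fin (m L) → Fock (Orb (FermionTorus 2 L))}
    (e : ∀ L, Fin (m L) ≃ Subtype (spinConfig (Λ := FermionTorus 2 L) (a L) (b L)))
    (hψ : ∀ L i, ψ L i = sectorEigenvector (spinConfig (a L) (b L)) (hubbardTorusTT' L t t' U)
      (hubbardTorusTT'_isHermitian L t t' U) (e L i)) (L : ℕ) (i : Fin (m L)) :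
    ψ L i ∈ szSector (a L + b L) ((((a L : ℝ)) - b L) / 2) := by
  rw [hψ L i, mem_szSector_iff_spinConfig]
  intro s hs
  simp [sectorEigenvector, sectorExtend, hs]

/-- **`D₄`-reduced thermal window certificates bound every torus limit of spin-sector canonical states.** Let
`ω` be a torus limit along `Ls → ∞` of the canonical Gibbs eigen-mixtures (any presentation `(m, p, ψ, e)`) of
`hubbardTorusTT' L t t' U` at inverse temperature `β` on the spin sectors `(a_L, b_L)` — e.g. a COMPANION state
of the two-sector rows. Then every thermal window certificate (the operator identity of
`re_expect_ge_of_thermal_certificate_TT'_of_rows` in `𝔄_{Λ'}`, `thicken Λ 1 ⊆ Λ'`, arbitrary affine-`D₄`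
labels, charged words of nonzero particle or spin charge, EEB generators `Aᵣ ∈ 𝔄_Λ` commuting with the local
`N` and `S^z`, slopes `e^{sᵣ−1} ≤ qᵣ`, multipliers `λᵣ, κₑ ≥ 0`, extra rows `Gₑ` with `0 ≤ Re ω_{Λ'}(Gₑ)`)
proves `c − Σₖ ‖aₖ‖ + Σ_σ μ_σ (Re ω_{Λ'}(n_{0σ}) − ν) + κ (u − e^{tt'}(ω)) ≤ Re ω_{Λ'}(Xw)`.
[cite: FawziFawziScalet2024, Thm. 3.6] [cite: Han2020Bootstrap, §3] -/
theorem IsTorusLimitOfMixture.re_expect_ge_of_thermal_certificate_d4_TT'_of_spinSectorGibbs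
    (t t' U β : ℝ) (a' b' : ℕ → ℕ) {mm : ℕ → ℕ} {p : ∀ L, Fin (mm L) → ℝ}
    {ψ : ∀ L, Fin (mm L) → Fock (Orb (FermionTorus 2 L))}
    (e : ∀ L, Fin (mm L) ≃ Subtype (spinConfig (Λ := FermionTorus 2 L) (a' L) (b' L)))
    (hp : ∀ L i, p L i = canonicalWeight β (sectorEigenvalue (spinConfig (a' L) (b' L)) (hubbardTorusTT' L t t' U)
      (hubbardTorusTT'_isHermitian L t t' U)) (e L i))
    (hψ : ∀ L i, ψ L i = sectorEigenvector (spinConfig (a' L) (b' L)) (hubbardTorusTT' L t t' U)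
      (hubbardTorusTT'_isHermitian L t t' U) (e L i))
    {Ls : ℕ → ℕ} (hLs : Tendsto Ls atTop atTop) {ω : InfVolFermionState 2}
    (h : ω.IsTorusLimitOfMixture mm p ψ Ls)
    {Λ Λ' : Finset (Site 2)} (hΛ : Λ ⊆ Λ') (h8 : thicken Λ 1 ⊆ Λ')
    (h0 : thicken ({0} : Finset (Site 2)) 1 ⊆ Λ') (hz : (0 : Site 2) ∈ Λ')
    (Xw : FermionOp Λ') (κ u : ℝ) (μ : Fin 2 → ℝ) (ν : ℝ)
    {m : Type*} [Fintype m] [DecidableEq m] {Λm : Matrix m m ℂ} (hΛm : Λm.PosSemidef)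
    (O : m → FermionOp Λ')
    {κ' : Type*} (s : Finset κ') (B : κ' → FermionOp Λ)
    {ι : Type*} (tt : Finset ι) (γ : ι → DihedralGroup 4) (wv : ι → Site 2)
    (hsh : ∀ l, d4ShiftSet (γ l) (wv l) Λ ⊆ Λ') (Y : ι → FermionOp Λ)
    {ρ : Type*} (uu : Finset ρ) (b : ρ → ℂ) (cw : ρ → List (Orb (PolySite Λ') × Bool))
    (hcw : ∀ j ∈ uu, ladderCharge (cw j) ≠ 0 ∨ ladderSpinCharge (cw j) ≠ 0)
    {θ : Type*} (rr : Finset θ) (lam : θ → ℝ) (hlam : ∀ r ∈ rr, 0 ≤ lam r) (A : θ → FermionOp Λ)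
    (hAN : ∀ r ∈ rr, Commute (A r) (totalNumber : FermionOp Λ))
    (hAS : ∀ r ∈ rr, Commute (A r) (HubbardWave0.spinZ : FermionOp Λ))
    (sv qv : θ → ℝ) (hq : ∀ r ∈ rr, Real.exp (sv r - 1) ≤ qv r)
    {η : Type*} (gg : Finset η) (kap : η → ℝ) (hkap : ∀ e ∈ gg, 0 ≤ kap e) (G : η → FermionOp Λ')
    (hG : ∀ e ∈ gg, 0 ≤ (ω.expect Λ' (G e)).re)
    {δ : Type*} (ah : Finset δ) (dc : δ → ℝ) (V : δ → FermionOp Λ')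
    {κ'' : Type*} (w : Finset κ'') (a : κ'' → ℂ) (word : κ'' → List (Orb (PolySite Λ') × Bool)) {c : ℝ}
    (hcert : Xw - (c : ℂ) • (1 : FermionOp Λ') -
        ∑ σ : Fin 2, ((μ σ : ℝ) : ℂ) • (nAt 0 hz σ - ((ν : ℝ) : ℂ) • (1 : FermionOp Λ')) -
        ((κ : ℝ) : ℂ) • (((u : ℝ) : ℂ) • (1 : FermionOp Λ') -
          fermionEmbed (PolySite.incl h0) ((hubbardTTPrimeFermionInteraction t t' U).meanEnergyObs 1)) =
      gramForm Λm O +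
        (∑ k ∈ s, ((hubbardTTPrimeFermionInteraction t t' U).localHamiltonian Λ' * fermionEmbed (PolySite.incl hΛ) (B k) -
            fermionEmbed (PolySite.incl hΛ) (B k) * (hubbardTTPrimeFermionInteraction t t' U).localHamiltonian Λ') +
          ∑ l ∈ tt, (fermionEmbed (PolySite.incl (hsh l)) (fermionEmbed (PolySite.d4Emb (γ l) (wv l) Λ) (Y l)) -
            fermionEmbed (PolySite.incl hΛ) (Y l)) +
          ∑ j ∈ uu, b j • ladderWord (cw j)) +
        (∑ r ∈ rr, ((lam r : ℝ) : ℂ) •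
            (((β : ℝ) : ℂ) • ((fermionEmbed (PolySite.incl hΛ) (A r))ᴴ *
                ((hubbardTTPrimeFermionInteraction t t' U).localHamiltonian Λ' * fermionEmbed (PolySite.incl hΛ) (A r) -
                  fermionEmbed (PolySite.incl hΛ) (A r) * (hubbardTTPrimeFermionInteraction t t' U).localHamiltonian Λ')) -
              ((sv r : ℝ) : ℂ) • ((fermionEmbed (PolySite.incl hΛ) (A r))ᴴ * fermionEmbed (PolySite.incl hΛ) (A r)) +
              ((qv r : ℝ) : ℂ) • (fermionEmbed (PolySite.incl hΛ) (A r) * (fermionEmbed (PolySite.incl hΛ) (A r))ᴴ)) +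
          ∑ e ∈ gg, ((kap e : ℝ) : ℂ) • G e) +
        (∑ m' ∈ ah, ((dc m' : ℝ) : ℂ) • ((V m')ᴴ - V m') + ∑ k ∈ w, a k • ladderWord (word k))) :
    c - ∑ k ∈ w, ‖a k‖ + ∑ σ : Fin 2, μ σ * ((ω.expect Λ' (nAt 0 hz σ)).re - ν) +
        κ * (u - ω.meanEnergy (hubbardTTPrimeFermionInteraction t t' U) 1) ≤
      (ω.expect Λ' Xw).re := by
  -- charged words: the components lie in a fixed joint sector
  have hS := sectorEigenvector_presentation_mem_szSector t t' U a' b' e hψ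
  have hch : ∀ j ∈ uu, ω.expect Λ' (ladderWord (cw j)) = 0 := fun j hj =>
    h.expect_ladderWord_eq_zero_of_szSector hLs hS (cw j) (hcw j hj)
  -- defects: translation and point-group invariance
  have hsym : ∀ l ∈ tt, ω.expect Λ'
      (fermionEmbed (PolySite.incl (hsh l)) (fermionEmbed (PolySite.d4Emb (γ l) (wv l) Λ) (Y l)) -
        fermionEmbed (PolySite.incl hΛ) (Y l)) = 0 := fun l _ =>
    h.expect_d4Defect_eq_zero_of_spinSectorGibbs t t' U β a' b' e hp hψ hLs hΛ (γ l) (wv l) (hsh l) (Y l)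
  -- eom rows: stationarity
  have heom : ∀ k ∈ s, ω.expect Λ'
      ((hubbardTTPrimeFermionInteraction t t' U).localHamiltonian Λ' * fermionEmbed (PolySite.incl hΛ) (B k) -
        fermionEmbed (PolySite.incl hΛ) (B k) * (hubbardTTPrimeFermionInteraction t t' U).localHamiltonian Λ') = 0 :=
    fun k _ => h.expect_commutator_localHamiltonian_eq_zero_of_spinSectorGibbs t t' U β a' b' e hp hψ hLs hΛ h8 (B k)
  -- EEB rows
  have heeb : ∀ r ∈ rr, 0 ≤ (ω.expect Λ'
      (((β : ℝ) : ℂ) • ((fermionEmbed (PolySite.incl hΛ) (A r))ᴴ *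
          ((hubbardTTPrimeFermionInteraction t t' U).localHamiltonian Λ' * fermionEmbed (PolySite.incl hΛ) (A r) -
            fermionEmbed (PolySite.incl hΛ) (A r) * (hubbardTTPrimeFermionInteraction t t' U).localHamiltonian Λ')) -
        ((sv r : ℝ) : ℂ) • ((fermionEmbed (PolySite.incl hΛ) (A r))ᴴ * fermionEmbed (PolySite.incl hΛ) (A r)) +
        ((qv r : ℝ) : ℂ) • (fermionEmbed (PolySite.incl hΛ) (A r) * (fermionEmbed (PolySite.incl hΛ) (A r))ᴴ))).re :=
    fun r hr => h.re_expect_eeb_nonneg_of_spinSectorGibbs_of_thicken_subset t t' U β a' b' e hp hψ hLs hΛ h8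
      (hAN r hr) (hAS r hr) (hq r hr)
  exact ω.re_expect_ge_of_thermal_certificate_TT'_of_rows t t' U β hΛ h0 hz Xw κ u μ ν hΛm O s B tt γ wv
    hsh Y uu b cw rr lam A sv qv gg kap G ah dc V w a word hcert heom hsym hch hlam heeb hkap hG

/-- **The reader for the «rm↑» companion `(k_L − 1, k_L)`, densities evaluated.** For `ω'` a torus limit along
`Ls → ∞` of the canonical eigen-mixtures of the sectors `(halfRectN n L − 1, halfRectN n L)` (`0 ≤ n ≤ 2`; the
companion of the two-sector rows of `c_{x↑}`), every thermal window certificate as above proves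
`c − Σₖ ‖aₖ‖ + (Σ_σ μ_σ)(n/2 − ν) + κ (u − e^{tt'}(ω')) ≤ Re ω'_{Λ'}(Xw)` — the record reader's conclusion
verbatim. Extra rows `Gₑ` for `ω'` by name: the energy window `e(n) ≤ e^{tt'}(ω') ≤ e(n) + 2H_b(n/2)/β`
(`…TwoSectorCompanionEnergyWindow`), the two-sector rows, D₄/translation/eom/EEB as discharged here.
[cite: FawziFawziScalet2024, Thm. 3.6] -/
theorem IsTorusLimitOfMixture.re_expect_ge_of_thermal_certificate_d4_TT'_of_predCompanion
    (t t' U β : ℝ) {n : ℝ} (hn0 : 0 ≤ n) (hn2 : n ≤ 2) {Ls : ℕ → ℕ} (hLs : Tendsto Ls atTop atTop)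
    {ω : InfVolFermionState 2}
    (h : ω.IsTorusLimitOfMixture
      (fun L => Fintype.card (Subtype (spinConfig (Λ := FermionTorus 2 L) (halfRectN n L - 1) (halfRectN n L))))
      (fun L i => canonicalWeight β (sectorEigenvalue (spinConfig (halfRectN n L - 1) (halfRectN n L))
        (hubbardTorusTT' L t t' U) (hubbardTorusTT'_isHermitian L t t' U)) ((Fintype.equivFin _).symm i))
      (fun L i => sectorEigenvector (spinConfig (halfRectN n L - 1) (halfRectN n L)) (hubbardTorusTT' L t t' U)
        (hubbardTorusTT'_isHermitian L t t' U) ((Fintype.equivFin _).symm i)) Ls)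
    {Λ Λ' : Finset (Site 2)} (hΛ : Λ ⊆ Λ') (h8 : thicken Λ 1 ⊆ Λ')
    (h0 : thicken ({0} : Finset (Site 2)) 1 ⊆ Λ') (hz : (0 : Site 2) ∈ Λ')
    (Xw : FermionOp Λ') (κ u : ℝ) (μ : Fin 2 → ℝ) (ν : ℝ)
    {m : Type*} [Fintype m] [DecidableEq m] {Λm : Matrix m m ℂ} (hΛm : Λm.PosSemidef)
    (O : m → FermionOp Λ')
    {κ' : Type*} (s : Finset κ') (B : κ' → FermionOp Λ)
    {ι : Type*} (tt : Finset ι) (γ : ι → DihedralGroup 4) (wv : ι → Site 2)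
    (hsh : ∀ l, d4ShiftSet (γ l) (wv l) Λ ⊆ Λ') (Y : ι → FermionOp Λ)
    {ρ : Type*} (uu : Finset ρ) (b : ρ → ℂ) (cw : ρ → List (Orb (PolySite Λ') × Bool))
    (hcw : ∀ j ∈ uu, ladderCharge (cw j) ≠ 0 ∨ ladderSpinCharge (cw j) ≠ 0)
    {θ : Type*} (rr : Finset θ) (lam : θ → ℝ) (hlam : ∀ r ∈ rr, 0 ≤ lam r) (A : θ → FermionOp Λ)
    (hAN : ∀ r ∈ rr, Commute (A r) (totalNumber : FermionOp Λ))
    (hAS : ∀ r ∈ rr, Commute (A r) (HubbardWave0.spinZ : FermionOp Λ))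
    (sv qv : θ → ℝ) (hq : ∀ r ∈ rr, Real.exp (sv r - 1) ≤ qv r)
    {η : Type*} (gg : Finset η) (kap : η → ℝ) (hkap : ∀ e ∈ gg, 0 ≤ kap e) (G : η → FermionOp Λ')
    (hG : ∀ e ∈ gg, 0 ≤ (ω.expect Λ' (G e)).re)
    {δ : Type*} (ah : Finset δ) (dc : δ → ℝ) (V : δ → FermionOp Λ')
    {κ'' : Type*} (w : Finset κ'') (a : κ'' → ℂ) (word : κ'' → List (Orb (PolySite Λ') × Bool)) {c : ℝ}
    (hcert : Xw - (c : ℂ) • (1 : FermionOp Λ') -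
        ∑ σ : Fin 2, ((μ σ : ℝ) : ℂ) • (nAt 0 hz σ - ((ν : ℝ) : ℂ) • (1 : FermionOp Λ')) -
        ((κ : ℝ) : ℂ) • (((u : ℝ) : ℂ) • (1 : FermionOp Λ') -
          fermionEmbed (PolySite.incl h0) ((hubbardTTPrimeFermionInteraction t t' U).meanEnergyObs 1)) =
      gramForm Λm O +
        (∑ k ∈ s, ((hubbardTTPrimeFermionInteraction t t' U).localHamiltonian Λ' * fermionEmbed (PolySite.incl hΛ) (B k) -
            fermionEmbed (PolySite.incl hΛ) (B k) * (hubbardTTPrimeFermionInteraction t t' U).localHamiltonian Λ') +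
          ∑ l ∈ tt, (fermionEmbed (PolySite.incl (hsh l)) (fermionEmbed (PolySite.d4Emb (γ l) (wv l) Λ) (Y l)) -
            fermionEmbed (PolySite.incl hΛ) (Y l)) +
          ∑ j ∈ uu, b j • ladderWord (cw j)) +
        (∑ r ∈ rr, ((lam r : ℝ) : ℂ) •
            (((β : ℝ) : ℂ) • ((fermionEmbed (PolySite.incl hΛ) (A r))ᴴ *
                ((hubbardTTPrimeFermionInteraction t t' U).localHamiltonian Λ' * fermionEmbed (PolySite.incl hΛ) (A r) -
                  fermionEmbed (PolySite.incl hΛ) (A r) * (hubbardTTPrimeFermionInteraction t t' U).localHamiltonian Λ')) -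
              ((sv r : ℝ) : ℂ) • ((fermionEmbed (PolySite.incl hΛ) (A r))ᴴ * fermionEmbed (PolySite.incl hΛ) (A r)) +
              ((qv r : ℝ) : ℂ) • (fermionEmbed (PolySite.incl hΛ) (A r) * (fermionEmbed (PolySite.incl hΛ) (A r))ᴴ)) +
          ∑ e ∈ gg, ((kap e : ℝ) : ℂ) • G e) +
        (∑ m' ∈ ah, ((dc m' : ℝ) : ℂ) • ((V m')ᴴ - V m') + ∑ k ∈ w, a k • ladderWord (word k))) :
    c - ∑ k ∈ w, ‖a k‖ + (∑ σ : Fin 2, μ σ) * (n / 2 - ν) +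
        κ * (u - ω.meanEnergy (hubbardTTPrimeFermionInteraction t t' U) 1) ≤
      (ω.expect Λ' Xw).re := by
  have hmain := h.re_expect_ge_of_thermal_certificate_d4_TT'_of_spinSectorGibbs t t' U β
    (fun L => halfRectN n L - 1) (fun L => halfRectN n L) (fun L => (Fintype.equivFin _).symm)
    (fun L i => rfl) (fun L i => rfl) hLs hΛ h8 h0 hz Xw κ u μ ν hΛm O s B tt γ wv hsh Y uu b cw hcw rr lam hlam A
    hAN hAS sv qv hq gg kap hkap G hG ah dc V w a word hcert
  -- densities: both `n/2`
  have hup : (ω.expect Λ' (nAt 0 hz 0)).re = n / 2 := by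
    rw [ω.expect_nAt_eq_expect_nAt_singleton hz 0]
    exact h.re_expect_nAt_up_eq_half_of_predCompanion t t' U β hn0 hn2 hLs
  have hdown : (ω.expect Λ' (nAt 0 hz 1)).re = n / 2 := by
    rw [ω.expect_nAt_eq_expect_nAt_singleton hz 1]
    exact h.re_expect_nAt_down_eq_half_of_predCompanion t t' U β hn0 hn2 hLs
  have hdens : ∑ σ : Fin 2, μ σ * ((ω.expect Λ' (nAt 0 hz σ)).re - ν) = (∑ σ : Fin 2, μ σ) * (n / 2 - ν) := by
    rw [Fin.sum_univ_two, Fin.sum_univ_two, hup, hdown]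
    ring
  rw [hdens] at hmain
  exact hmain

/-- **The reader for the PAIR companion `(k_L − 1, k_L − 1)`, densities evaluated** (`0 ≤ n ≤ 2`): the same
conclusion `c − Σₖ ‖aₖ‖ + (Σ_σ μ_σ)(n/2 − ν) + κ (u − e^{tt'}(ω'')) ≤ Re ω''_{Λ'}(Xw)`.
[cite: FawziFawziScalet2024, Thm. 3.6] -/
theorem IsTorusLimitOfMixture.re_expect_ge_of_thermal_certificate_d4_TT'_of_pairCompanion
    (t t' U β : ℝ) {n : ℝ} (hn0 : 0 ≤ n) (hn2 : n ≤ 2) {Ls : ℕ → ℕ} (hLs : Tendsto Ls atTop atTop)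
    {ω : InfVolFermionState 2}
    (h : ω.IsTorusLimitOfMixture
      (fun L => Fintype.card (Subtype (spinConfig (Λ := FermionTorus 2 L) (halfRectN n L - 1) (halfRectN n L - 1))))
      (fun L i => canonicalWeight β (sectorEigenvalue (spinConfig (halfRectN n L - 1) (halfRectN n L - 1))
        (hubbardTorusTT' L t t' U) (hubbardTorusTT'_isHermitian L t t' U)) ((Fintype.equivFin _).symm i))
      (fun L i => sectorEigenvector (spinConfig (halfRectN n L - 1) (halfRectN n L - 1)) (hubbardTorusTT' L t t' U)
        (hubbardTorusTT'_isHermitian L t t' U) ((Fintype.equivFin _).symm i)) Ls)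
    {Λ Λ' : Finset (Site 2)} (hΛ : Λ ⊆ Λ') (h8 : thicken Λ 1 ⊆ Λ')
    (h0 : thicken ({0} : Finset (Site 2)) 1 ⊆ Λ') (hz : (0 : Site 2) ∈ Λ')
    (Xw : FermionOp Λ') (κ u : ℝ) (μ : Fin 2 → ℝ) (ν : ℝ)
    {m : Type*} [Fintype m] [DecidableEq m] {Λm : Matrix m m ℂ} (hΛm : Λm.PosSemidef)
    (O : m → FermionOp Λ')
    {κ' : Type*} (s : Finset κ') (B : κ' → FermionOp Λ)
    {ι : Type*} (tt : Finset ι) (γ : ι → DihedralGroup 4) (wv : ι → Site 2)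
    (hsh : ∀ l, d4ShiftSet (γ l) (wv l) Λ ⊆ Λ') (Y : ι → FermionOp Λ)
    {ρ : Type*} (uu : Finset ρ) (b : ρ → ℂ) (cw : ρ → List (Orb (PolySite Λ') × Bool))
    (hcw : ∀ j ∈ uu, ladderCharge (cw j) ≠ 0 ∨ ladderSpinCharge (cw j) ≠ 0)
    {θ : Type*} (rr : Finset θ) (lam : θ → ℝ) (hlam : ∀ r ∈ rr, 0 ≤ lam r) (A : θ → FermionOp Λ)
    (hAN : ∀ r ∈ rr, Commute (A r) (totalNumber : FermionOp Λ))
    (hAS : ∀ r ∈ rr, Commute (A r) (HubbardWave0.spinZ : FermionOp Λ))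
    (sv qv : θ → ℝ) (hq : ∀ r ∈ rr, Real.exp (sv r - 1) ≤ qv r)
    {η : Type*} (gg : Finset η) (kap : η → ℝ) (hkap : ∀ e ∈ gg, 0 ≤ kap e) (G : η → FermionOp Λ')
    (hG : ∀ e ∈ gg, 0 ≤ (ω.expect Λ' (G e)).re)
    {δ : Type*} (ah : Finset δ) (dc : δ → ℝ) (V : δ → FermionOp Λ')
    {κ'' : Type*} (w : Finset κ'') (a : κ'' → ℂ) (word : κ'' → List (Orb (PolySite Λ') × Bool)) {c : ℝ}
    (hcert : Xw - (c : ℂ) • (1 : FermionOp Λ') -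
        ∑ σ : Fin 2, ((μ σ : ℝ) : ℂ) • (nAt 0 hz σ - ((ν : ℝ) : ℂ) • (1 : FermionOp Λ')) -
        ((κ : ℝ) : ℂ) • (((u : ℝ) : ℂ) • (1 : FermionOp Λ') -
          fermionEmbed (PolySite.incl h0) ((hubbardTTPrimeFermionInteraction t t' U).meanEnergyObs 1)) =
      gramForm Λm O +
        (∑ k ∈ s, ((hubbardTTPrimeFermionInteraction t t' U).localHamiltonian Λ' * fermionEmbed (PolySite.incl hΛ) (B k) -
            fermionEmbed (PolySite.incl hΛ) (B k) * (hubbardTTPrimeFermionInteraction t t' U).localHamiltonian Λ') +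
          ∑ l ∈ tt, (fermionEmbed (PolySite.incl (hsh l)) (fermionEmbed (PolySite.d4Emb (γ l) (wv l) Λ) (Y l)) -
            fermionEmbed (PolySite.incl hΛ) (Y l)) +
          ∑ j ∈ uu, b j • ladderWord (cw j)) +
        (∑ r ∈ rr, ((lam r : ℝ) : ℂ) •
            (((β : ℝ) : ℂ) • ((fermionEmbed (PolySite.incl hΛ) (A r))ᴴ *
                ((hubbardTTPrimeFermionInteraction t t' U).localHamiltonian Λ' * fermionEmbed (PolySite.incl hΛ) (A r) -
                  fermionEmbed (PolySite.incl hΛ) (A r) * (hubbardTTPrimeFermionInteraction t t' U).localHamiltonian Λ')) -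
              ((sv r : ℝ) : ℂ) • ((fermionEmbed (PolySite.incl hΛ) (A r))ᴴ * fermionEmbed (PolySite.incl hΛ) (A r)) +
              ((qv r : ℝ) : ℂ) • (fermionEmbed (PolySite.incl hΛ) (A r) * (fermionEmbed (PolySite.incl hΛ) (A r))ᴴ)) +
          ∑ e ∈ gg, ((kap e : ℝ) : ℂ) • G e) +
        (∑ m' ∈ ah, ((dc m' : ℝ) : ℂ) • ((V m')ᴴ - V m') + ∑ k ∈ w, a k • ladderWord (word k))) :
    c - ∑ k ∈ w, ‖a k‖ + (∑ σ : Fin 2, μ σ) * (n / 2 - ν) +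
        κ * (u - ω.meanEnergy (hubbardTTPrimeFermionInteraction t t' U) 1) ≤
      (ω.expect Λ' Xw).re := by
  have hmain := h.re_expect_ge_of_thermal_certificate_d4_TT'_of_spinSectorGibbs t t' U β
    (fun L => halfRectN n L - 1) (fun L => halfRectN n L - 1) (fun L => (Fintype.equivFin _).symm)
    (fun L i => rfl) (fun L i => rfl) hLs hΛ h8 h0 hz Xw κ u μ ν hΛm O s B tt γ wv hsh Y uu b cw hcw rr lam hlam A
    hAN hAS sv qv hq gg kap hkap G hG ah dc V w a word hcert
  have hab : ∀ᶠ j in atTop, halfRectN n (Ls j) - 1 ≤ Ls j * Ls j ∧ halfRectN n (Ls j) - 1 ≤ Ls j * Ls j :=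
    Eventually.of_forall fun j =>
      ⟨(Nat.sub_le _ _).trans (halfRectN_le_mul_self hn0 hn2 (Ls j)),
        (Nat.sub_le _ _).trans (halfRectN_le_mul_self hn0 hn2 (Ls j))⟩
  have hdd := h.re_expect_nAt_eq_of_spinSectorGibbs t t' U β (fun L => halfRectN n L - 1) (fun L => halfRectN n L - 1)
    (fun _ => (Fintype.equivFin _).symm) (fun _ _ => rfl) (fun _ _ => rfl) hLs hab
  have hup : (ω.expect Λ' (nAt 0 hz 0)).re = n / 2 := by
    rw [ω.expect_nAt_eq_expect_nAt_singleton hz 0]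
    exact hdd.1 (tendsto_halfRectN_pred_div_sq_comp hn0 hLs)
  have hdown : (ω.expect Λ' (nAt 0 hz 1)).re = n / 2 := by
    rw [ω.expect_nAt_eq_expect_nAt_singleton hz 1]
    exact hdd.2 (tendsto_halfRectN_pred_div_sq_comp hn0 hLs)
  have hdens : ∑ σ : Fin 2, μ σ * ((ω.expect Λ' (nAt 0 hz σ)).re - ν) = (∑ σ : Fin 2, μ σ) * (n / 2 - ν) := by
    rw [Fin.sum_univ_two, Fin.sum_univ_two, hup, hdown]
    ring
  rw [hdens] at hmain
  exact hmain

end InfVolFermionState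

end Literature.MathematicalPhysics.QuantumLattice

end
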